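import Literature.MathematicalPhysics.QuantumFieldTheory.Balaban1983to89.Node00.OpsYHolderFar
import Literature.MathematicalPhysics.QuantumFieldTheory.Balaban1983to89.Node00.OpsYRead342
import Literature.MathematicalPhysics.QuantumFieldTheory.Balaban1983to89.B9Ineq349SiteComposite

/-!
# `Balaban1983to89.B9SectBH1ReadWriteY` — the (3.43) READ ∕ WRITE DICTIONARY between def-Y's Hölder reader `hLatS` and its PAIR PROBES, IN U-LETTERS FOR AN
# ARBITRARY OPERATOR `T` (`hLatS i (fun _ => T) (fun _ => par) U`: the reading of `T` — e.g. `G′(U)` or the continued `G′(U′U)` — with the derivatives and the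
# transporters OF `U`), and its linearity in the algebra direction (general `𝔸`-valued inputs `Σ_j f_j ⊗ b_j`)

T. Bałaban, *Propagators for lattice gauge theories in a background field*, Commun. Math. Phys. **99** (1985) 389–434
[`Balaban1985BackgroundPropagators`, "B9"]; [4] = T. Bałaban, *Propagators and renormalization transformations for lattice gauge
theories. II*, Commun. Math. Phys. **96** (1984) 223–250 [`Balaban1984PropagatorsII`].

statement-level skeleton of published theorems with citation tags; proofs where landed; nothing here is a claim about the
Yang–Mills mass gap

THE PRINTED LOCI.  (3.40) p. 397 (the covariant Hölder quotient with `R(U(Γ_{x,x′}))`, *"determined by a configuration U"*), (3.43) p. 398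
(`‖ζ∇_UG′λ‖_β`, `‖ζG′∇*_Uλ‖_β`), Theorem 3.4 p. 400 and p. 403 l.4–7 (the bounds for the continued `G′(U′U)` in the norms of `U`); [4] (2.51)–(2.52) p. 232.

WHY THIS FILE (seat dag-n06-c gen 11; LOCATED-11 on the bus, 2026-08-28, with lit-balaban-r06's print confirmation and node00-def-Y's preliminary direction
R13-U1: Sect.-B outputs at products are read IN U-LETTERS — the operator is `G′(U′U)`, the letters `∇_U`, `U(Γ)` are those of the base `U`).  def-Y's Hölder
reader `Node00.OpsYOfLetters.hLatS i O par U Λ α ζ` reads the operator `O U` and the transporter `par U`; fed the CONSTANT families `fun _ => T`, `fun _ => p` it reads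
ANY fixed operator `T` with ANY fixed transporter `p` and the derivatives of `U` — no new reader is needed.  The letters-level Sect.-B frame for (3.43)
(`B9SectBGpStepAtLettersV2.H1Frame₂.h1_transfer`) speaks of PROBES: for each pair `z ≠ z′`, slot `μ`, side and direction `E`, the single quotient
`‖R(U(Γ_{z,z′}))Ψ(z′) − Ψ(z)‖∕(η|z′−z|_T)^α` of the ζ-localised letter word `Ψ`.  THIS FILE is the two-way dictionary between the reading and its probes, and the
linearity that turns bounds for tensor inputs `f ⊗ E` into bounds for general `𝔸`-valued inputs `Σ_j f_j ⊗ b_j` (cost `Σ_j ‖b_j‖`, as in g7's (3.42) dictionary):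
* §1 words `wordS ζ W Λ` (`W` = `∇_{U,μ} ∘ T` or `T ∘ ∇*_{U,μ}`), probes `quotS`, the reading `h1ReadT` = `⨆_E hLatS i (fun _ => T) (fun _ => par) U (f ⊗ E) α ζ`;
* §2 linearity of words and numerators, subadditivity ∕ homogeneity of the probe;
* §3 a UNIFORM bound over the unit ball (basis decomposition, `|repr_j E| ≤ M₂‖E‖`) — the `BddAbove` the reader's `⨆_E` needs;
* §4 READ: ★ `hqS_wordL∕R_le_h1ReadT`, ★ `quotL∕R_le_h1ReadT` (every probe at a unit-ball direction is below the reading);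
* §5 WRITE: ★★ `h1ReadT_le_of_probes` (a common bound `B ≥ 0` on all probes bounds the reading);
* §6 GENERAL INPUTS: ★★ `quotL∕R_sum_le_of_h1ReadT` (the probe of the word at `Σ_j f_j ⊗ b_j` is at most `Σ_j ‖b_j‖·B_j` under reading bounds `h1ReadT f_j ≤ B_j`);
* §7 ★ `kernelFamilyS_h1_inl` — def-Y's `kernelFamilyS.h1` IS `h1ReadT (O (cfg U′)) (par (cfg U′)) (cfg U′)` (`rfl`).
HONEST SCOPE.  Elementary bookkeeping over def-Y's landed readers (`iSup` over finite types and the unit ball, linearity of `R(p)`, `∇_U`, `∇*_U`, `T`); nothing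
of [B9] asserted; no unitarity used; COUNT-NEUTRAL; N06 NOT discharged; one finite lattice programme — nothing continuum, nothing about OS positivity or the mass gap.
-/

noncomputable section

namespace Literature.MathematicalPhysics.QuantumFieldTheory.Balaban1983to89.B9SectBH1ReadWriteY

open B9Eq39Adjoint (R R_smul R_zero R_sub R_add)
open B6KLevelCensusIndexV1 (KIdx)
open B9Ineq349SiteComposite (cdSL cdsSL)
open Node00 (SiteY CfgY BallY liftY liftY_apply hqS hLatS etaS cdS cdsS iSup_ball_le)
open Node00.OpsYHolderFar (denS denS_nonneg pair_le_hqS hqS_le_of_forall hqS_nonneg)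
open Node00.OpsYRead342 (liftY_eq_sum_repr liftY_smul_right)

variable {d ℓ : ℕ} {hd : 1 ≤ d + 1} {hL : Odd (ℓ + 1) ∧ 1 < ℓ + 1} {b₀ b₁ : ℝ}
variable {𝔸 : Type} [NormedRing 𝔸] [NormedAlgebra ℂ 𝔸] [CompleteSpace 𝔸]
variable (i : KIdx d ℓ hd hL b₀ b₁)

/-! ## §1 Words, probes, the reading -/

/-- the ζ-LOCALISED WORD of (3.43): `z ↦ (ζ(z)·η)·(WΛ)(z)` for a letter word `W` (`∇_{U,μ} ∘ T` on the left, `T ∘ ∇*_{U,μ}` on the right).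
[cite: Balaban1985BackgroundPropagators, (3.43) p.398] -/
def wordS (ζ : SiteY i → ℝ) (W : (SiteY i → 𝔸) →ₗ[ℂ] (SiteY i → 𝔸)) (Λ : SiteY i → 𝔸) : SiteY i → 𝔸 :=
  fun z => ((ζ z * etaS i : ℝ) : ℂ) • W Λ z

/-- **a PAIR PROBE** of a word `Ψ` at `(z, z′)`: `‖R(U(Γ_{z,z′}))Ψ(z′) − Ψ(z)‖ ∕ (η|z′ − z|_T)^α`. [cite: Balaban1985BackgroundPropagators, (3.40) p.397] -/
def quotS (par : SiteY i → SiteY i → 𝔸ˣ) (α : ℝ) (Ψ : SiteY i → 𝔸) (z z' : SiteY i) : ℝ :=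
  ‖R (par z z') (Ψ z') - Ψ z‖ / denS i α z z'

/-- **THE (3.43) READING OF A FIXED OPERATOR `T` IN THE LETTERS OF `U` WITH THE TRANSPORTER `par`**:
`⨆_{‖E‖≤1} hLatS i (fun _ => T) (fun _ => par) U (f ⊗ E) α ζ` — def-Y's `kernelFamilyS.h1` when `T = O U`, `par = parS U`; the product-aware reading of
LOCATED-11's repair R13-U1 when `T = G′(U′U)` (letters and transporter of the base `U`). [cite: Balaban1985BackgroundPropagators, (3.43) p.398, (3.40) p.397, p.403 l.4–7] -/
def h1ReadT (T : (SiteY i → 𝔸) →ₗ[ℂ] (SiteY i → 𝔸)) (par : SiteY i → SiteY i → 𝔸ˣ) (U : CfgY 𝔸 i) (f : SiteY i → ℝ) (α : ℝ)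
    (ζ : SiteY i → ℝ) : ℝ :=
  ⨆ E : BallY 𝔸, hLatS i (fun _ => T) (fun _ => par) U (liftY f (E : 𝔸)) α ζ

omit [NormedAlgebra ℂ 𝔸] [CompleteSpace 𝔸] in
/-- `0 ≤ quotS`. [cite: Balaban1985BackgroundPropagators, (3.40) p.397, bookkeeping] -/
theorem quotS_nonneg (par : SiteY i → SiteY i → 𝔸ˣ) (α : ℝ) (Ψ : SiteY i → 𝔸) (z z' : SiteY i) : 0 ≤ quotS i par α Ψ z z' :=
  div_nonneg (norm_nonneg _) (denS_nonneg i α z z')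

/-- `hLatS` of the constant families, unfolded: the `⨆` over (slot, side) of the `hqS` of the two words.
[cite: Balaban1985BackgroundPropagators, (3.43) p.398, bookkeeping] -/
theorem hLatS_const_eq (T : (SiteY i → 𝔸) →ₗ[ℂ] (SiteY i → 𝔸)) (par : SiteY i → SiteY i → 𝔸ˣ) (U : CfgY 𝔸 i) (Λ : SiteY i → 𝔸) (α : ℝ)
    (ζ : SiteY i → ℝ) :
    hLatS i (fun _ => T) (fun _ => par) U Λ α ζ =
      ⨆ p : Fin (d + 1) × Bool, if p.2 then hqS i par α (wordS i ζ (cdSL i U p.1 ∘ₗ T) Λ) else hqS i par α (wordS i ζ (T ∘ₗ cdsSL i U p.1) Λ) := rfl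

/-- `0 ≤ hLatS`. [cite: Balaban1985BackgroundPropagators, (3.43) p.398, bookkeeping] -/
theorem hLatS_const_nonneg (T : (SiteY i → 𝔸) →ₗ[ℂ] (SiteY i → 𝔸)) (par : SiteY i → SiteY i → 𝔸ˣ) (U : CfgY 𝔸 i) (Λ : SiteY i → 𝔸) (α : ℝ)
    (ζ : SiteY i → ℝ) : 0 ≤ hLatS i (fun _ => T) (fun _ => par) U Λ α ζ := by
  rw [hLatS_const_eq]
  refine Real.iSup_nonneg fun p => ?_
  split_ifs <;> exact hqS_nonneg i par α _

/-- `0 ≤ h1ReadT`. [cite: Balaban1985BackgroundPropagators, (3.43) p.398, bookkeeping] -/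
theorem h1ReadT_nonneg (T : (SiteY i → 𝔸) →ₗ[ℂ] (SiteY i → 𝔸)) (par : SiteY i → SiteY i → 𝔸ˣ) (U : CfgY 𝔸 i) (f : SiteY i → ℝ) (α : ℝ)
    (ζ : SiteY i → ℝ) : 0 ≤ h1ReadT i T par U f α ζ :=
  Real.iSup_nonneg fun _ => hLatS_const_nonneg i T par U _ α ζ

/-- each word's `hqS` is below `hLatS` (left words). [cite: Balaban1985BackgroundPropagators, (3.43) p.398, bookkeeping] -/
theorem hqS_wordL_le_hLatS (T : (SiteY i → 𝔸) →ₗ[ℂ] (SiteY i → 𝔸)) (par : SiteY i → SiteY i → 𝔸ˣ) (U : CfgY 𝔸 i) (Λ : SiteY i → 𝔸) (α : ℝ)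
    (ζ : SiteY i → ℝ) (μ : Fin (d + 1)) :
    hqS i par α (wordS i ζ (cdSL i U μ ∘ₗ T) Λ) ≤ hLatS i (fun _ => T) (fun _ => par) U Λ α ζ := by
  rw [hLatS_const_eq]
  exact le_ciSup_of_le (Finite.bddAbove_range _) (μ, true) (by simp)

/-- each word's `hqS` is below `hLatS` (right words). [cite: Balaban1985BackgroundPropagators, (3.43) p.398, bookkeeping] -/
theorem hqS_wordR_le_hLatS (T : (SiteY i → 𝔸) →ₗ[ℂ] (SiteY i → 𝔸)) (par : SiteY i → SiteY i → 𝔸ˣ) (U : CfgY 𝔸 i) (Λ : SiteY i → 𝔸) (α : ℝ)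
    (ζ : SiteY i → ℝ) (μ : Fin (d + 1)) :
    hqS i par α (wordS i ζ (T ∘ₗ cdsSL i U μ) Λ) ≤ hLatS i (fun _ => T) (fun _ => par) U Λ α ζ := by
  rw [hLatS_const_eq]
  exact le_ciSup_of_le (Finite.bddAbove_range _) (μ, false) (by simp)

/-- intro rule for `hLatS` of the constant families: a common bound `B ≥ 0` on the `hqS` of all words. [cite: Balaban1985BackgroundPropagators, (3.43) p.398, bookkeeping] -/
theorem hLatS_const_le (T : (SiteY i → 𝔸) →ₗ[ℂ] (SiteY i → 𝔸)) (par : SiteY i → SiteY i → 𝔸ˣ) (U : CfgY 𝔸 i) (Λ : SiteY i → 𝔸) (α : ℝ)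
    (ζ : SiteY i → ℝ) {B : ℝ} (hB : 0 ≤ B) (hL : ∀ μ, hqS i par α (wordS i ζ (cdSL i U μ ∘ₗ T) Λ) ≤ B)
    (hR : ∀ μ, hqS i par α (wordS i ζ (T ∘ₗ cdsSL i U μ) Λ) ≤ B) : hLatS i (fun _ => T) (fun _ => par) U Λ α ζ ≤ B := by
  rw [hLatS_const_eq]
  refine Real.iSup_le (fun p => ?_) hB
  split_ifs
  · exact hL p.1
  · exact hR p.1

/-! ## §2 Linearity of the words and of the probe numerators -/

omit [CompleteSpace 𝔸] in
/-- the word is additive in the input. [cite: Balaban1985BackgroundPropagators, (3.43) p.398, bookkeeping] -/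
theorem wordS_add (ζ : SiteY i → ℝ) (W : (SiteY i → 𝔸) →ₗ[ℂ] (SiteY i → 𝔸)) (Λ₁ Λ₂ : SiteY i → 𝔸) :
    wordS i ζ W (Λ₁ + Λ₂) = wordS i ζ W Λ₁ + wordS i ζ W Λ₂ := by
  funext z; simp only [wordS, map_add, Pi.add_apply, smul_add]

omit [CompleteSpace 𝔸] in
/-- the word is ℝ-homogeneous in the input. [cite: Balaban1985BackgroundPropagators, (3.43) p.398, bookkeeping] -/
theorem wordS_smul (ζ : SiteY i → ℝ) (W : (SiteY i → 𝔸) →ₗ[ℂ] (SiteY i → 𝔸)) (c : ℝ) (Λ : SiteY i → 𝔸) :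
    wordS i ζ W (c • Λ) = c • wordS i ζ W Λ := by
  funext z
  have h : W (c • Λ) = c • W Λ := LinearMap.map_smul_of_tower W c Λ
  simp only [wordS, h, Pi.smul_apply, smul_comm c]

omit [CompleteSpace 𝔸] in
/-- the word of a finite sum. [cite: Balaban1985BackgroundPropagators, (3.43) p.398, bookkeeping] -/
theorem wordS_sum {κ : Type} (s : Finset κ) (ζ : SiteY i → ℝ) (W : (SiteY i → 𝔸) →ₗ[ℂ] (SiteY i → 𝔸)) (Λ : κ → SiteY i → 𝔸) :
    wordS i ζ W (∑ j ∈ s, Λ j) = ∑ j ∈ s, wordS i ζ W (Λ j) := by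
  classical
  induction s using Finset.induction_on with
  | empty =>
    funext z; simp [wordS]
  | insert a s ha ih => rw [Finset.sum_insert ha, Finset.sum_insert ha, wordS_add, ih]

omit [NormedAlgebra ℂ 𝔸] [CompleteSpace 𝔸] in
/-- the probe numerator is additive. [cite: Balaban1985BackgroundPropagators, (3.40) p.397, bookkeeping] -/
theorem num_add (p : 𝔸ˣ) (Ψ₁ Ψ₂ : SiteY i → 𝔸) (z z' : SiteY i) :
    R p ((Ψ₁ + Ψ₂) z') - (Ψ₁ + Ψ₂) z = (R p (Ψ₁ z') - Ψ₁ z) + (R p (Ψ₂ z') - Ψ₂ z) := by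
  simp only [Pi.add_apply, R_add]; abel

omit [CompleteSpace 𝔸] in
/-- the probe numerator is ℝ-homogeneous. [cite: Balaban1985BackgroundPropagators, (3.40) p.397, bookkeeping] -/
theorem num_smul (p : 𝔸ˣ) (c : ℝ) (Ψ : SiteY i → 𝔸) (z z' : SiteY i) :
    R p ((c • Ψ) z') - (c • Ψ) z = c • (R p (Ψ z') - Ψ z) := by
  simp only [Pi.smul_apply, R_smul, smul_sub]

omit [NormedAlgebra ℂ 𝔸] [CompleteSpace 𝔸] in
/-- the probe numerator of a finite sum. [cite: Balaban1985BackgroundPropagators, (3.40) p.397, bookkeeping] -/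
theorem num_sum {κ : Type} (s : Finset κ) (p : 𝔸ˣ) (Ψ : κ → SiteY i → 𝔸) (z z' : SiteY i) :
    R p ((∑ j ∈ s, Ψ j) z') - (∑ j ∈ s, Ψ j) z = ∑ j ∈ s, (R p (Ψ j z') - Ψ j z) := by
  classical
  induction s using Finset.induction_on with
  | empty => simp
  | insert a s ha ih => rw [Finset.sum_insert ha, Finset.sum_insert ha, num_add, ih]

omit [CompleteSpace 𝔸] in
/-- the probe is ℝ-homogeneous: `quot(c·Ψ) = |c|·quot(Ψ)`. [cite: Balaban1985BackgroundPropagators, (3.40) p.397, bookkeeping] -/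
theorem quotS_smul (par : SiteY i → SiteY i → 𝔸ˣ) (α : ℝ) (c : ℝ) (Ψ : SiteY i → 𝔸) (z z' : SiteY i) :
    quotS i par α (c • Ψ) z z' = |c| * quotS i par α Ψ z z' := by
  unfold quotS
  have h : R (par z z') ((c • Ψ) z') - (c • Ψ) z = c • (R (par z z') (Ψ z') - Ψ z) := by
    simp only [Pi.smul_apply, R, smul_sub, mul_smul_comm, smul_mul_assoc]
  rw [h, norm_smul, Real.norm_eq_abs, mul_div_assoc]

omit [NormedAlgebra ℂ 𝔸] [CompleteSpace 𝔸] in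
/-- the probe is subadditive over finite sums. [cite: Balaban1985BackgroundPropagators, (3.40) p.397, bookkeeping] -/
theorem quotS_sum_le {κ : Type} (s : Finset κ) (par : SiteY i → SiteY i → 𝔸ˣ) (α : ℝ) (Ψ : κ → SiteY i → 𝔸) (z z' : SiteY i) :
    quotS i par α (∑ j ∈ s, Ψ j) z z' ≤ ∑ j ∈ s, quotS i par α (Ψ j) z z' := by
  classical
  unfold quotS
  rw [← Finset.sum_div]
  refine div_le_div_of_nonneg_right ?_ (denS_nonneg i α z z')
  have h : R (par z z') ((∑ j ∈ s, Ψ j) z') - (∑ j ∈ s, Ψ j) z = ∑ j ∈ s, (R (par z z') (Ψ j z') - Ψ j z) := by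
    induction s using Finset.induction_on with
    | empty => simp [R]
    | insert a s ha ih =>
      rw [Finset.sum_insert ha, Finset.sum_insert ha, ← ih]
      simp only [Pi.add_apply, R, mul_add, add_mul]; abel
  rw [h]
  exact norm_sum_le _ _

/-! ## §3 The uniform bound over the unit ball (the `BddAbove` of the reader's `⨆_E`) -/

section Ball

variable {ι : Type} [Fintype ι] (b : Module.Basis ι ℝ 𝔸)

omit [CompleteSpace 𝔸] in
/-- the word at `f ⊗ E`, decomposed along the basis: `Σ_j repr_j(E)·word(f ⊗ b_j)`. [cite: Balaban1985BackgroundPropagators, (3.39) p.397, bookkeeping] -/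
theorem wordS_liftY_eq_sum (ζ : SiteY i → ℝ) (W : (SiteY i → 𝔸) →ₗ[ℂ] (SiteY i → 𝔸)) (f : SiteY i → ℝ) (E : 𝔸) :
    wordS i ζ W (liftY f E) = ∑ j, b.repr E j • wordS i ζ W (liftY f (b j)) := by
  rw [liftY_eq_sum_repr b f E, wordS_sum]
  exact Finset.sum_congr rfl fun j _ => wordS_smul i ζ W _ _

omit [CompleteSpace 𝔸] in
/-- ★ the probe at a direction `E` against the basis probes: `quot(word(f ⊗ E)) ≤ M₂‖E‖·Σ_j quot(word(f ⊗ b_j))` under `|repr_j v| ≤ M₂‖v‖`.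
[cite: Balaban1985BackgroundPropagators, (3.40) p.397 + (3.39) p.397, bookkeeping] -/
theorem quotS_liftY_le (ζ : SiteY i → ℝ) (W : (SiteY i → 𝔸) →ₗ[ℂ] (SiteY i → 𝔸)) (par : SiteY i → SiteY i → 𝔸ˣ) (α : ℝ)
    {M₂ : ℝ} (hrepr : ∀ (v : 𝔸) (j : ι), |b.repr v j| ≤ M₂ * ‖v‖) (f : SiteY i → ℝ) (E : 𝔸) (z z' : SiteY i) :
    quotS i par α (wordS i ζ W (liftY f E)) z z' ≤ M₂ * ‖E‖ * ∑ j, quotS i par α (wordS i ζ W (liftY f (b j))) z z' := by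
  rw [wordS_liftY_eq_sum i b, Finset.mul_sum]
  refine (quotS_sum_le i _ par α _ z z').trans (Finset.sum_le_sum fun j _ => ?_)
  rw [quotS_smul]
  exact mul_le_mul_of_nonneg_right (hrepr E j) (quotS_nonneg i par α _ z z')

/-- ★ a UNIFORM bound of `hLatS` over the unit ball: `hLatS(f ⊗ E) ≤ M₂·Σ_j hLatS(f ⊗ b_j)` for `‖E‖ ≤ 1`.
[cite: Balaban1985BackgroundPropagators, (3.43) p.398 (sup over |λ| ≤ 1), bookkeeping] -/
theorem hLatS_liftY_le_sum (T : (SiteY i → 𝔸) →ₗ[ℂ] (SiteY i → 𝔸)) (par : SiteY i → SiteY i → 𝔸ˣ) (U : CfgY 𝔸 i) (α : ℝ)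
    (ζ : SiteY i → ℝ) {M₂ : ℝ} (hM₂ : 0 ≤ M₂) (hrepr : ∀ (v : 𝔸) (j : ι), |b.repr v j| ≤ M₂ * ‖v‖) (f : SiteY i → ℝ) {E : 𝔸}
    (hE : ‖E‖ ≤ 1) :
    hLatS i (fun _ => T) (fun _ => par) U (liftY f E) α ζ ≤ M₂ * ∑ j, hLatS i (fun _ => T) (fun _ => par) U (liftY f (b j)) α ζ := by
  have hS : 0 ≤ ∑ j, hLatS i (fun _ => T) (fun _ => par) U (liftY f (b j)) α ζ :=
    Finset.sum_nonneg fun j _ => hLatS_const_nonneg i T par U _ α ζ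
  have hB : 0 ≤ M₂ * ∑ j, hLatS i (fun _ => T) (fun _ => par) U (liftY f (b j)) α ζ := mul_nonneg hM₂ hS
  have key : ∀ W : (SiteY i → 𝔸) →ₗ[ℂ] (SiteY i → 𝔸),
      (∀ j, hqS i par α (wordS i ζ W (liftY f (b j))) ≤ hLatS i (fun _ => T) (fun _ => par) U (liftY f (b j)) α ζ) →
      hqS i par α (wordS i ζ W (liftY f E)) ≤ M₂ * ∑ j, hLatS i (fun _ => T) (fun _ => par) U (liftY f (b j)) α ζ := by
    intro W hW
    refine hqS_le_of_forall i par α _ hB fun z z' hne => ?_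
    refine (quotS_liftY_le i b ζ W par α hrepr f E z z').trans ?_
    calc M₂ * ‖E‖ * ∑ j, quotS i par α (wordS i ζ W (liftY f (b j))) z z'
        ≤ M₂ * 1 * ∑ j, hLatS i (fun _ => T) (fun _ => par) U (liftY f (b j)) α ζ := by
          refine mul_le_mul (mul_le_mul_of_nonneg_left hE hM₂) (Finset.sum_le_sum fun j _ => ?_)
            (Finset.sum_nonneg fun j _ => quotS_nonneg i par α _ z z') (mul_nonneg hM₂ zero_le_one)
          exact (pair_le_hqS i par α _ hne).trans (hW j)
      _ = M₂ * ∑ j, hLatS i (fun _ => T) (fun _ => par) U (liftY f (b j)) α ζ := by rw [mul_one]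
  exact hLatS_const_le i T par U _ α ζ hB (fun μ => key _ fun j => hqS_wordL_le_hLatS i T par U _ α ζ μ)
    (fun μ => key _ fun j => hqS_wordR_le_hLatS i T par U _ α ζ μ)

/-- the range of the reader's integrand over the unit ball is bounded above. [cite: Balaban1985BackgroundPropagators, (3.43) p.398, bookkeeping] -/
theorem bddAbove_hLatS_ball (T : (SiteY i → 𝔸) →ₗ[ℂ] (SiteY i → 𝔸)) (par : SiteY i → SiteY i → 𝔸ˣ) (U : CfgY 𝔸 i) (α : ℝ)
    (ζ : SiteY i → ℝ) {M₂ : ℝ} (hM₂ : 0 ≤ M₂) (hrepr : ∀ (v : 𝔸) (j : ι), |b.repr v j| ≤ M₂ * ‖v‖) (f : SiteY i → ℝ) :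
    BddAbove (Set.range fun E : BallY 𝔸 => hLatS i (fun _ => T) (fun _ => par) U (liftY f (E : 𝔸)) α ζ) :=
  ⟨M₂ * ∑ j, hLatS i (fun _ => T) (fun _ => par) U (liftY f (b j)) α ζ, by
    rintro _ ⟨E, rfl⟩
    exact hLatS_liftY_le_sum i b T par U α ζ hM₂ hrepr f (mem_closedBall_zero_iff.1 E.2)⟩

/-! ## §4 READ: every probe at a unit-ball direction is below the reading -/

/-- ★ `hLatS(f ⊗ E) ≤ h1ReadT` for `‖E‖ ≤ 1`. [cite: Balaban1985BackgroundPropagators, (3.43) p.398, bookkeeping] -/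
theorem hLatS_le_h1ReadT (T : (SiteY i → 𝔸) →ₗ[ℂ] (SiteY i → 𝔸)) (par : SiteY i → SiteY i → 𝔸ˣ) (U : CfgY 𝔸 i) (α : ℝ)
    (ζ : SiteY i → ℝ) {M₂ : ℝ} (hM₂ : 0 ≤ M₂) (hrepr : ∀ (v : 𝔸) (j : ι), |b.repr v j| ≤ M₂ * ‖v‖) (f : SiteY i → ℝ) (E : BallY 𝔸) :
    hLatS i (fun _ => T) (fun _ => par) U (liftY f (E : 𝔸)) α ζ ≤ h1ReadT i T par U f α ζ :=
  le_ciSup (bddAbove_hLatS_ball i b T par U α ζ hM₂ hrepr f) E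

/-- ★ **READ, LEFT WORDS**: every pair probe of `ζη·∇_{U,μ}T(f ⊗ E)` is below the reading. [cite: Balaban1985BackgroundPropagators, (3.43) p.398, (3.40) p.397] -/
theorem quotL_le_h1ReadT (T : (SiteY i → 𝔸) →ₗ[ℂ] (SiteY i → 𝔸)) (par : SiteY i → SiteY i → 𝔸ˣ) (U : CfgY 𝔸 i) (α : ℝ)
    (ζ : SiteY i → ℝ) {M₂ : ℝ} (hM₂ : 0 ≤ M₂) (hrepr : ∀ (v : 𝔸) (j : ι), |b.repr v j| ≤ M₂ * ‖v‖) (f : SiteY i → ℝ) (E : BallY 𝔸)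
    (μ : Fin (d + 1)) {z z' : SiteY i} (hne : z ≠ z') :
    quotS i par α (wordS i ζ (cdSL i U μ ∘ₗ T) (liftY f (E : 𝔸))) z z' ≤ h1ReadT i T par U f α ζ :=
  ((pair_le_hqS i par α _ hne).trans (hqS_wordL_le_hLatS i T par U _ α ζ μ)).trans (hLatS_le_h1ReadT i b T par U α ζ hM₂ hrepr f E)

/-- ★ **READ, RIGHT WORDS**: every pair probe of `ζη·T∇*_{U,μ}(f ⊗ E)` is below the reading. [cite: Balaban1985BackgroundPropagators, (3.43) p.398, (3.40) p.397] -/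
theorem quotR_le_h1ReadT (T : (SiteY i → 𝔸) →ₗ[ℂ] (SiteY i → 𝔸)) (par : SiteY i → SiteY i → 𝔸ˣ) (U : CfgY 𝔸 i) (α : ℝ)
    (ζ : SiteY i → ℝ) {M₂ : ℝ} (hM₂ : 0 ≤ M₂) (hrepr : ∀ (v : 𝔸) (j : ι), |b.repr v j| ≤ M₂ * ‖v‖) (f : SiteY i → ℝ) (E : BallY 𝔸)
    (μ : Fin (d + 1)) {z z' : SiteY i} (hne : z ≠ z') :
    quotS i par α (wordS i ζ (T ∘ₗ cdsSL i U μ) (liftY f (E : 𝔸))) z z' ≤ h1ReadT i T par U f α ζ :=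
  ((pair_le_hqS i par α _ hne).trans (hqS_wordR_le_hLatS i T par U _ α ζ μ)).trans (hLatS_le_h1ReadT i b T par U α ζ hM₂ hrepr f E)

end Ball

/-! ## §5 WRITE: a common bound on all probes bounds the reading -/

/-- ★★ **WRITE**: if `B ≥ 0` bounds every pair probe (`z ≠ z′`) of every left word `ζη·∇_{U,μ}T(f ⊗ E)` and every right word `ζη·T∇*_{U,μ}(f ⊗ E)`,
`‖E‖ ≤ 1`, then `h1ReadT T par U f α ζ ≤ B`. [cite: Balaban1985BackgroundPropagators, (3.43) p.398, (3.40) p.397] -/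
theorem h1ReadT_le_of_probes (T : (SiteY i → 𝔸) →ₗ[ℂ] (SiteY i → 𝔸)) (par : SiteY i → SiteY i → 𝔸ˣ) (U : CfgY 𝔸 i) (f : SiteY i → ℝ)
    (α : ℝ) (ζ : SiteY i → ℝ) {B : ℝ} (hB : 0 ≤ B)
    (hL : ∀ (E : BallY 𝔸) (μ : Fin (d + 1)) (z z' : SiteY i), z ≠ z' → quotS i par α (wordS i ζ (cdSL i U μ ∘ₗ T) (liftY f (E : 𝔸))) z z' ≤ B)
    (hR : ∀ (E : BallY 𝔸) (μ : Fin (d + 1)) (z z' : SiteY i), z ≠ z' → quotS i par α (wordS i ζ (T ∘ₗ cdsSL i U μ) (liftY f (E : 𝔸))) z z' ≤ B) :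
    h1ReadT i T par U f α ζ ≤ B :=
  iSup_ball_le (fun E => hLatS_const_le i T par U _ α ζ hB
    (fun μ => hqS_le_of_forall i par α _ hB fun z z' hne => hL E μ z z' hne)
    (fun μ => hqS_le_of_forall i par α _ hB fun z z' hne => hR E μ z z' hne)) hB

/-! ## §6 General `𝔸`-valued inputs: `Σ_j f_j ⊗ b_j` -/

section General

variable {ι : Type} [Fintype ι] (b : Module.Basis ι ℝ 𝔸)

omit [CompleteSpace 𝔸] in
/-- `f ⊗ v = ‖v‖·(f ⊗ v̂)` with `v̂ = ‖v‖⁻¹v` in the unit ball (`v ≠ 0`). [cite: Balaban1985BackgroundPropagators, (3.39) p.397, bookkeeping] -/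
theorem liftY_eq_norm_smul_unit (f : SiteY i → ℝ) {v : 𝔸} (hv : v ≠ 0) :
    liftY (X := SiteY i) f v = ‖v‖ • liftY f (‖v‖⁻¹ • v) := by
  have hn : ‖v‖ ≠ 0 := norm_ne_zero_iff.2 hv
  funext w
  rw [Pi.smul_apply, liftY_apply, liftY_apply, smul_comm ((f w : ℝ) : ℂ) (‖v‖⁻¹) v, ← mul_smul, mul_inv_cancel₀ hn, one_smul]

omit [CompleteSpace 𝔸] in
/-- the normalised vector is in the unit ball. [folklore] -/
private theorem norm_inv_smul_le_one (v : 𝔸) : ‖(‖v‖⁻¹ • v : 𝔸)‖ ≤ 1 := by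
  by_cases hv : v = 0
  · simp [hv]
  · rw [norm_smul, norm_inv, norm_norm, inv_mul_cancel₀ (norm_ne_zero_iff.2 hv)]

/-- ★★ **GENERAL INPUTS, LEFT WORDS**: the pair probe of the left word at `Σ_j f_j ⊗ b_j` is at most `Σ_j ‖b_j‖·B_j` under reading bounds `h1ReadT T par U f_j ≤ B_j`
(the basis vectors normalised into the unit ball; `|repr| ≤ M₂‖·‖` serves the `BddAbove` only). [cite: Balaban1985BackgroundPropagators, (3.43) p.398, (3.39)–(3.40) p.397; Balaban1984PropagatorsII, (2.51)–(2.52) p.232] -/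
theorem quotL_sum_le_of_h1ReadT (T : (SiteY i → 𝔸) →ₗ[ℂ] (SiteY i → 𝔸)) (par : SiteY i → SiteY i → 𝔸ˣ) (U : CfgY 𝔸 i) (α : ℝ)
    (ζ : SiteY i → ℝ) {M₂ : ℝ} (hM₂ : 0 ≤ M₂) (hrepr : ∀ (v : 𝔸) (j : ι), |b.repr v j| ≤ M₂ * ‖v‖) (fj : ι → SiteY i → ℝ) (Bj : ι → ℝ)
    (hB : ∀ j, h1ReadT i T par U (fj j) α ζ ≤ Bj j) (μ : Fin (d + 1)) {z z' : SiteY i} (hne : z ≠ z') :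
    quotS i par α (wordS i ζ (cdSL i U μ ∘ₗ T) (∑ j, liftY (fj j) (b j))) z z' ≤ ∑ j, ‖b j‖ * Bj j := by
  rw [wordS_sum]
  refine (quotS_sum_le i _ par α _ z z').trans (Finset.sum_le_sum fun j _ => ?_)
  have hbj : b j ≠ 0 := b.ne_zero j
  rw [liftY_eq_norm_smul_unit i (fj j) hbj, wordS_smul, quotS_smul, abs_norm]
  refine mul_le_mul_of_nonneg_left ?_ (norm_nonneg _)
  have h := quotL_le_h1ReadT i b T par U α ζ hM₂ hrepr (fj j) ⟨‖b j‖⁻¹ • b j, mem_closedBall_zero_iff.2 (norm_inv_smul_le_one (b j))⟩ μ hne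
  exact h.trans (hB j)

/-- ★★ **GENERAL INPUTS, RIGHT WORDS.** [cite: Balaban1985BackgroundPropagators, (3.43) p.398, (3.39)–(3.40) p.397; Balaban1984PropagatorsII, (2.51)–(2.52) p.232] -/
theorem quotR_sum_le_of_h1ReadT (T : (SiteY i → 𝔸) →ₗ[ℂ] (SiteY i → 𝔸)) (par : SiteY i → SiteY i → 𝔸ˣ) (U : CfgY 𝔸 i) (α : ℝ)
    (ζ : SiteY i → ℝ) {M₂ : ℝ} (hM₂ : 0 ≤ M₂) (hrepr : ∀ (v : 𝔸) (j : ι), |b.repr v j| ≤ M₂ * ‖v‖) (fj : ι → SiteY i → ℝ) (Bj : ι → ℝ)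
    (hB : ∀ j, h1ReadT i T par U (fj j) α ζ ≤ Bj j) (μ : Fin (d + 1)) {z z' : SiteY i} (hne : z ≠ z') :
    quotS i par α (wordS i ζ (T ∘ₗ cdsSL i U μ) (∑ j, liftY (fj j) (b j))) z z' ≤ ∑ j, ‖b j‖ * Bj j := by
  rw [wordS_sum]
  refine (quotS_sum_le i _ par α _ z z').trans (Finset.sum_le_sum fun j _ => ?_)
  have hbj : b j ≠ 0 := b.ne_zero j
  rw [liftY_eq_norm_smul_unit i (fj j) hbj, wordS_smul, quotS_smul, abs_norm]
  refine mul_le_mul_of_nonneg_left ?_ (norm_nonneg _)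
  have h := quotR_le_h1ReadT i b T par U α ζ hM₂ hrepr (fj j) ⟨‖b j‖⁻¹ • b j, mem_closedBall_zero_iff.2 (norm_inv_smul_le_one (b j))⟩ μ hne
  exact h.trans (hB j)

end General

/-! ## §7 The bridge to def-Y's family reading -/

/-- ★ def-Y's (3.43) member IS the reading of the operator `O U` with the transporter `par U` in the letters of `U` (`rfl`): every lemma of this file applies
to `kernelFamilyS.h1` verbatim (`T := O (cfg U′)`, `par := par (cfg U′)`), and to a product-aware reader built from the constant families likewise.
[cite: Balaban1985BackgroundPropagators, (3.43) p.398, bookkeeping] -/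
theorem kernelFamilyS_h1_inl (B : B9.Backgrounds) (cfg : B.Cfg → CfgY 𝔸 i) (O : Node00.SiteOpY 𝔸 i) (par : Node00.SiteParY 𝔸 i) (U' : B.Cfg)
    (f : SiteY i → ℝ) (α : ℝ) (z : SiteY i → ℝ) :
    (Node00.kernelFamilyS i B cfg O par).h1 U' (.inl f) α (.inl z) = h1ReadT i (O (cfg U')) (par (cfg U')) (cfg U') f α z := rfl

end Literature.MathematicalPhysics.QuantumFieldTheory.Balaban1983to89.B9SectBH1ReadWriteY

end
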